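import Summits.QuantumFields.YangMills.Theorems.IR.AfPincerUcSharpOnset
import Summits.QuantumFields.YangMills.Theorems.IR.BlockedActivityTyp
import HarnessLib

/-!
# Crux `IR` (stmt-QuantumFields-19354), lane B «strong coupling AFTER BLOCKING»: the NT-CALIBRATED construction statement and its
# by-name path to the route decl `IR` on the simply connected family with NO X-stub (owner R100 (3))

Helper module for item `stmt-QuantumFields-19354` (`--supports`; it closes nothing), lane `ym-19354-onsetsc-p2`.  Adopted from the
crux-plan desk's HOME-only template `template-laneB-calibrated.lean` (cplan g12, sha16 58f5d50853b0e30a; source cplan port rev 2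
71577857bd55b2bd), re-homed in the lane's namespace `…IR.BlockedActivity`.

* `BlockedActivityOnsetCalSC` = the lane's construction statement `BlockedActivityOnsetSC` (`Theorems/IR/BlockedActivityDefs`, p527934)
  with the witness mesh CALIBRATED against the NT unit map: binders `a`, `LowerBounds G r a` in scope and, for every activity radius
  `act > 0`, «`∃ T β₂, ∀ β ≥ β₂, ∃ b ≥ 1, a β · b < T ∧ BlockedActivityClass r.ρ β b 1 act`» (`T` fixed before `β₂`; no `δ` — the
  currency is σ-uniform).  «Blocking to `b ≍ ξ_lat(β)`, and `ξ_lat(β) · a(β)` stays bounded in any unit in which the theory is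
  non-trivial.»
* `univOnsetSharpSC_of_blockedActivityOnsetCalSC` — ⇒ cplan's universal sharp currency `SharpOnset.UnivOnsetSharpSC`
  (`univShellCond_of_blockedActivity_radius`, p528785, at `(n, ε) = (1, 1/3552)`, radius `radius (1/3552) ∈ (10⁻⁹⁰, 10⁻⁸⁸)`).
* **`ir_of_blockedActivityOnsetCalSC : BlockedActivityOnsetCalSC → SharpOnset.IRNSC → Theses.BalabanLadder.IR`** — the ROUTE DECL from
  the calibrated lane-B statement and the NSC residual alone: NO X-stub (`stub_afOnsetUc`), E discharged (p524017), via
  `SharpOnset.ir_of_univOnsetSharpSC` (X′ is free at a calibrated mesh, cf. p528589 `lateOnsetAt_iff_unbounded_onsetInUnits`).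
* **Typ-RELATIVISED form (owner R95 ∕ R98 (3), cplan (6d))**: `BlockedActivityTypOnsetCalSC` = the hereditary sharp construction
  statement of `SharpOnset.ir_of_activitySupplierHereditarySharpSC` with `Act := BlockedActivityTypAll` (`Theorems/IR/BlockedActivityTyp`)
  and `r₀ n ε := radiusT ε`: per mesh-`b(β)` frame (calibrated, `a β · b < T`) SOME measurable cell-local class `Typ` with the blocked
  representation of radius `radiusT ε` RELATIVE to `Typ`-data at every centre, clause (ii) in UKP form and clause (iii) at budget `δ`;
  **`ir_of_blockedActivityTypOnsetCalSC : BlockedActivityTypOnsetCalSC → SharpOnset.IRNSC → Theses.BalabanLadder.IR`** (adapter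
  `clauseIAll_of_blockedActivityTypAll_radiusT`; no X-stub).  This statement is NOT exposed to the uniform wire (the class may exclude
  wire data at rarity cost `δ`); it is the lane's intended end-state format.
* `not_blockedActivityOnsetCalSC_of_uniformWire` — EXPOSURE by name: a uniform boundary-order wire on ONE simply connected compact
  simple group with an NT unit map refutes the calibrated σ-uniform statement (`SharpOnset.not_univOnsetSharpSC_of_uniformWire`).
  The statement therefore BETS «no `OnsetWire.UniformWire` for simply connected `G` at any mesh» (owner R95∕R98 (3)); the
  Typ-relativised class is the intended end-state.

HONEST FRAMING: a reduction among OPEN statements of a CONDITIONAL chain; `BlockedActivityOnsetCalSC` is complete-analyticity-strength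
open content (no source; not claimed); nothing here proves weak-coupling mixing or a gap; not Clay.  No `sorry`; axioms ⊆ {propext,
Classical.choice, Quot.sound}.
-/

set_option autoImplicit false

noncomputable section

open Filter Topology MeasureTheory
open Literature.MathematicalPhysics.QuantumFieldTheory Literature.MathematicalPhysics.QuantumLattice
open Summit.QuantumFields.YangMills.Cruxes.OSLegsFromFemtoAndGap.DlrCollarTransfer (LowerBounds)
open Summit.QuantumFields.YangMills.Cruxes.IR.OnsetFormats (shellCount UnivShellCond)
open Summit.QuantumFields.YangMills.Cruxes.IR.AfPincerUc (IsFrame TypLocal ClauseIIukp ClauseIII TypShellCondUKPc)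
open Summit.QuantumFields.YangMills.Cruxes.IR.AfPincerUc.SharpOnset (IRNSC UnivOnsetSharpSC OnsetSharpUKPcSC ir_of_univOnsetSharpSC
  not_univOnsetSharpSC_of_uniformWire ir_of_activitySupplierHereditarySharpSC)

namespace Summit.QuantumFields.YangMills.Cruxes.IR.BlockedActivity

/-- **Lane B, NT-calibrated (owner R100 (3))**: on the simply connected family, for every `(G, r)`, every positive unit map `a → 0`
with `LowerBounds G r a` and every activity radius `act > 0`, a blocked-activity representation of radius `act` (window `1`) at a
mesh `b(β) ≥ 1` with `a β · b < T(act)` for all large `β`.  OPEN research content (complete-analyticity strength); not asserted. -/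
def BlockedActivityOnsetCalSC : Prop :=
  ∀ (G : Type) [Group G] [TopologicalSpace G] [IsTopologicalGroup G] [CompactSpace G],
    IsCompactSimpleLieGroup G → SimplyConnectedSpace G →
    letI : MeasurableSpace G := borel G; haveI : BorelSpace G := ⟨rfl⟩;
    ∀ (r : LatticeRep G) (a : ℝ → ℝ), (∀ β, 0 < a β) → Tendsto a atTop (𝓝 0) → LowerBounds G r a →
      ∀ act : ℝ, 0 < act → ∃ T β₂ : ℝ, ∀ β : ℝ, β₂ ≤ β → ∃ b : ℕ, 1 ≤ b ∧ a β * (b : ℝ) < T ∧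
        BlockedActivityClass r.ρ β b 1 act

/-- **Calibrated lane B ⇒ the universal sharp currency** at `(n, ε) = (1, 1/3552)` (`ε · shellCount 1 = 1/2 ≤ 3/4`), radius
`radius (1/3552)` (tree `univShellCond_of_blockedActivity_radius`). -/
theorem univOnsetSharpSC_of_blockedActivityOnsetCalSC (h : BlockedActivityOnsetCalSC) : UnivOnsetSharpSC := by
  intro G _ _ _ _ hG hsc
  letI : MeasurableSpace G := borel G
  haveI : BorelSpace G := ⟨rfl⟩
  intro r a ha hat hlb
  have hε : (0 : ℝ) < 1 / 3552 := by norm_num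
  obtain ⟨T, β₂, hb⟩ := h G hG hsc r a ha hat hlb (radius (1 / 3552)) (radius_pos hε)
  refine ⟨1, 1 / 3552, le_rfl, hε.le, ?_, T, β₂, fun β hβ => ?_⟩
  · rw [shellCount_one]; norm_num
  · obtain ⟨b, hb1, hlt, hC⟩ := hb β hβ
    exact ⟨b, hb1, hlt, univShellCond_of_blockedActivity_radius hC (by norm_num) le_rfl⟩

/-- **Calibrated lane B ∧ R_NSC ⇒ the route decl `IR`, with NO X-stub** (E discharged by p524017; cplan `SharpOnset.ir_of_univOnsetSharpSC`). -/
theorem ir_of_blockedActivityOnsetCalSC (h : BlockedActivityOnsetCalSC) (hN : IRNSC) :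
    Summit.QuantumFields.YangMills.Theses.BalabanLadder.IR :=
  ir_of_univOnsetSharpSC (univOnsetSharpSC_of_blockedActivityOnsetCalSC h) hN

/-- **Exposure**: a uniform boundary-order wire (`OnsetWire.UniformWire`) on one simply connected compact simple group carrying an NT
unit map refutes the calibrated σ-uniform statement (PROVED modulo the wire; cplan `SharpOnset.not_univOnsetSharpSC_of_uniformWire`). -/
theorem not_blockedActivityOnsetCalSC_of_uniformWire (G : Type) [Group G] [TopologicalSpace G] [IsTopologicalGroup G]
    [CompactSpace G] (hG : IsCompactSimpleLieGroup G) (hsc : SimplyConnectedSpace G)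
    (hW : letI : MeasurableSpace G := borel G; haveI : BorelSpace G := ⟨rfl⟩;
      ∃ r : LatticeRep G, OnsetWire.UniformWire r.ρ ∧
        ∃ a : ℝ → ℝ, (∀ β, 0 < a β) ∧ Tendsto a atTop (𝓝 0) ∧ LowerBounds G r a) : ¬ BlockedActivityOnsetCalSC :=
  fun h => not_univOnsetSharpSC_of_uniformWire G hG hsc hW (univOnsetSharpSC_of_blockedActivityOnsetCalSC h)

/-! ## The Typ-relativised, NT-calibrated construction statement (cplan (6d) instantiated) -/

/-- **Lane B, Typ-RELATIVISED and NT-calibrated** — the `hcons` of `SharpOnset.ir_of_activitySupplierHereditarySharpSC` with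
`Act := BlockedActivityTypAll`, `r₀ n ε := radiusT ε`: on the simply connected family, for every `(G, r)` and NT unit map `a`, some
admissible `(n, ε)` such that for every rarity budget `δ > 0`, at all large `β`, SOME calibrated mesh `b(β)` (`a β · b < T`) carries on
every mesh-`b` frame a measurable cell-local class `Typ` with (i♭) the blocked representation of radius `radiusT ε` relative to `Typ`-data
at every centre, (ii) hereditary UKP rarity and (iii) the torus anchor at budget `δ`.  OPEN research content; not asserted. -/
def BlockedActivityTypOnsetCalSC : Prop :=
  ∀ (G : Type) [Group G] [TopologicalSpace G] [IsTopologicalGroup G] [CompactSpace G],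
    IsCompactSimpleLieGroup G → SimplyConnectedSpace G →
    letI : MeasurableSpace G := borel G; haveI : BorelSpace G := ⟨rfl⟩;
    ∀ (r : LatticeRep G) (a : ℝ → ℝ), (∀ β, 0 < a β) → Tendsto a atTop (𝓝 0) → LowerBounds G r a →
      ∃ (n : ℕ) (ε : ℝ), 1 ≤ n ∧ 0 ≤ ε ∧ ε * shellCount n ≤ 3 / 4 ∧
        ∀ δ : ℝ, 0 < δ → ∃ T β₂ : ℝ, ∀ β : ℝ, β₂ ≤ β → ∃ b : ℕ, 1 ≤ b ∧ a β * (b : ℝ) < T ∧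
          ∀ w : Fin 4 → ℤ → ℤ, IsFrame b w → ∃ Typ : (Fin 4 → ℤ) → Set (LGConfig 4 G),
            TypLocal w Typ ∧ BlockedActivityTypAll r.ρ β w n (radiusT ε) Typ ∧ ClauseIIukp r.ρ β w δ Typ ∧ ClauseIII r.ρ β w b δ Typ

/-- **Typ-relativised calibrated lane B ∧ R_NSC ⇒ the route decl `IR`, with NO X-stub** (cplan (6d) `ir_of_activitySupplierHereditarySharpSC`
instantiated with `Act := BlockedActivityTypAll`, `r₀ n ε := radiusT ε`, `hadapt := clauseIAll_of_blockedActivityTypAll_radiusT`). -/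
theorem ir_of_blockedActivityTypOnsetCalSC (h : BlockedActivityTypOnsetCalSC) (hN : IRNSC) :
    Summit.QuantumFields.YangMills.Theses.BalabanLadder.IR :=
  ir_of_activitySupplierHereditarySharpSC (Act := @BlockedActivityTypAll) (r₀ := fun _ ε => radiusT ε)
    (hadapt := fun _ _ _ _ _ _ hA => clauseIAll_of_blockedActivityTypAll_radiusT hA) h hN

/-- The σ-uniform calibrated statement implies the Typ-relativised one (class `Typ ≡ univ`: (ii), (iii) bound the measure of `∅`). -/
theorem blockedActivityTypOnsetCalSC_of_cal (h : BlockedActivityOnsetCalSC) : BlockedActivityTypOnsetCalSC := by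
  intro G _ _ _ _ hG hsc
  letI : MeasurableSpace G := borel G
  haveI : BorelSpace G := ⟨rfl⟩
  intro r a ha hat hlb
  have hε : (0 : ℝ) < 1 / 3552 := by norm_num
  obtain ⟨T, β₂, hb⟩ := h G hG hsc r a ha hat hlb (radiusT (1 / 3552)) (radiusT_pos hε)
  refine ⟨1, 1 / 3552, le_rfl, hε.le, ?_, fun δ hδ => ⟨T, β₂, fun β hβ => ?_⟩⟩
  · rw [shellCount_one]; norm_num
  · obtain ⟨b, hb1, hlt, hC⟩ := hb β hβ
    refine ⟨b, hb1, hlt, fun w hw => ⟨fun _ => Set.univ, ?_, ?_, ?_, ?_⟩⟩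
    · exact ⟨fun _ => MeasurableSet.univ, fun _ _ _ _ => by simp⟩
    · intro c₀
      exact blockedActivityTyp_of_blockedActivityClass hC
        (Summit.QuantumFields.YangMills.Cruxes.IR.CellTempered.Engine.shiftFrame_mesh hw c₀) _
    · intro F F' _ hF ζ _
      obtain ⟨c, hc⟩ := hF
      refine (measure_mono (t := (∅ : Set (LGConfig 4 G))) fun σ hσ => ?_).trans (by simp)
      exact (hσ c hc (Set.mem_univ _)).elim
    · intro S _ F hF _
      obtain ⟨c, hc⟩ := hF
      refine (measure_mono (t := (∅ : Set (GaugeConfig 4 (2 * S + 1) G))) fun V hV => ?_).trans (by simp)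
      exact (hV c hc (Set.mem_univ _)).elim

end Summit.QuantumFields.YangMills.Cruxes.IR.BlockedActivity

end
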